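import Summits.BirchSwinnertonDyer.Rank1Residual.Additive.CyclotomicCharacterOnStableLine
import Summits.BirchSwinnertonDyer.Rank1Residual.GaloisImage.ExoticNoHigherLevelTau
import HarnessLib

/-!
# On a SMALL-IMAGE row Sakamoto's hypothesis (H.2) FAILS ALREADY AT LEVEL ONE: no `τ ∈ Γ_{ℚ(μ_p)}`
# has `E[p]/(τ − 1)E[p] ≃ ℤ/p` when `E[p]` is irreducible and `ρ̄_{E,p}` is not onto — O8-TAME part 11d
# (cell `b2b-bsdres`, lane CLASS-CLOSURE, seat cc-typer-1 = typer of record N11 / O8, GEN 10; joint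
# small-image axis O8 / N2 / N3; the O8 counterpart of n1011-p13's `ExoticNoLevelTwoTau.lean`)

HONEST FRAMING (cell `b2b-bsdres`, run/shared/lean/b2b/bsd-rank1-residual/, verbatim in every
file): the goal of the cell is to DELETE the COMBINATION-SHAPED residual classes of the
Birch–Swinnerton-Dyer formula for ALL analytic-rank `≤ 1` elliptic curves over `ℚ` — "full BSD
formula for every rank `≤ 1` curve in class `C`" assembled STRICTLY from published theorems — so
that the rank-`≤ 1` remainder becomes exactly the CONSTRUCTION-SHAPED classes, which are TYPED
(missing-input `Prop`s), NOT attempted. This is not "finishing BSD". THEOREMS ONLY: no definition,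
no named fact, no conjecture node, nothing booked, no label of `RESIDUAL-MAP.md` moved; census
counts are EVIDENCE, never a Literature fact.

## What this file does

Parts 11b–11c proved that Sakamoto's hypothesis (H.3) at level one HOLDS on every O8 row at `p = 3`
and on the `(G) ∧ ss` rows at every odd `p`, surjective image or not. This file locates the
hypothesis of the [S24] / [MR04] Kolyvagin-system machinery that FAILS on the small-image rows, in
the currency of the N11 instances (n1011-p13's `kolyvaginSystems_freeRankOne_propagatedSelmerStructure`,
binders `hτμ : τ ∈ rootsOfUnityFixer ℚ (3^(k+1))`,
`hτq : Nonempty (cokerSubOne (E[3^k·3]) τ ≃+ ZMod (3^(k+1)))`): **(H.2) — "some `τ ∈ G_{ℚ(μ)}` has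
`T/(τ − 1)T` free of rank one" — fails at EVERY level, already at level one.**

* §1 **`not_nonempty_cokerSubOne_equiv_zmod_of_irr_of_not_surj`** — `Irr W p`, `¬ Surj W p`,
  `τ ∈ Gal(ℚ̄/ℚ(μ_p))` ⟹ `E[p]/(τ − 1)E[p] ≄ ℤ/p`. PROOF: if `E[p]/R ≃ ℤ/p` for `R = (τ − 1)E[p]` then
  `#R = p` (`#E[p] = p²`, Lagrange), `τ` acts trivially on `E[p]/R` by construction, so `τ` acts on
  the line `R` by the scalar `χ̄_p(τ)` (cc-typer-1 GEN 7 `smul_eq_cyclotomic_zsmul_of_forall_sub_mem`: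
  the determinant read on a flag) `= 1` (`τ` fixes `μ_p`: `rootsOfUnityFixer_eq_ker`); then `τ` is
  unipotent, hence TRIVIAL on `E[p]` (GEN 7 `smul_eq_self_of_fix_line_of_irr_of_not_surj`: a proper
  irreducible subgroup of `GL₂(𝔽_p)` with full determinant has no element of order `p`, Serre 1972
  Prop. 15), so `R = 0`, not of order `p`.
* §2 **`not_nonempty_cokerSubOne_equiv_zmod_pow_of_irr_of_not_surj`** — the same at every level
  `p^a`, `a ≥ 1` (`τ ∈ Gal(ℚ̄/ℚ(μ_{p^a}))` ⟹ `E[p^a]/(τ − 1) ≄ ℤ/p^a`): n1011-p13's descent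
  `nonempty_cokerSubOne_equiv_zmod_pow_of_le` brings a level-`p^a` datum down to level `p`.
  **`not_nonempty_cokerSubOne_three_pow_of_irr_of_not_surj`** — the SPELLING of the N11 instances
  (`rootsOfUnityFixer ℚ (3^(k+1))`, `torsionGaloisModule ((3:ℤ)^k · 3)`, `ZMod (3^(k+1))`), every `k`.
* §3 class forms: **`O8.not_nonempty_cokerSubOne_equiv_zmod`** (every O8 row, every `p`, level one),
  **`O8.not_nonempty_cokerSubOne_three_pow`** (O8 at `3`, the instance spelling, every `k`),
  **`ClassX10.not_nonempty_cokerSubOne_three_pow_of_not_surj`** (N2 = X10b), and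
  **`ClassX9.not_nonempty_cokerSubOne_equiv_zmod`** (N3 = X9, `p ∈ {5, 7, …}`).

READING (E2 obstruction anatomy of the joint small-image target, theorem level): on O8 / N2 / N3 the
binder `hτq` of every [S24]-instance in the tree is UNSATISFIABLE — those instances are VACUOUS there
(as GEN 2's `eq_one_of_isCyclicKolyvaginLevel_of_irr_of_not_surj` is the Frobenius / Kolyvagin-PRIME
form of the same fact); together with parts 11b–11c: (H.2) ✗ (here), (H.3)@1 ✓ (`p = 3` all rows;
`(G) ∧ ss` all odd `p`), irreducibility ✓, Kato (12.5.2) ✗ (n1011-p04 `O8.image_hypotheses_fail`).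
NOT claimed: anything positive; any class theorem of BSD type; no label moves.

References: [Sakamoto2024] R. Sakamoto, JTNB 36 (2024) §2 (H.2); [MazurRubin2004] B. Mazur,
K. Rubin, Mem. AMS 799 (2004) §3.5 (H.1); [Serre1972] J.-P. Serre, Invent. Math. 15 (1972) §1.11,
§2.4 Prop. 15; [SilvermanAEC2009] *AEC* III.6.4(b), III.8.1.
-/

set_option autoImplicit false

noncomputable section

open scoped Classical NumberField

open Field IsDedekindDomain NumberField WeierstrassCurve
  Literature.NumberTheory.EllipticCurves Literature.NumberTheory.GaloisRepresentations
  Literature.NumberTheory.GaloisRepresentations.DiscreteGaloisModule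
  Literature.NumberTheory.GaloisCohomology
  Literature.NumberTheory.EllipticCurves.Rank1Residual
  Summit.BirchSwinnertonDyer.Rank1Residual.Additive

namespace Summit.BirchSwinnertonDyer.Rank1Residual.GaloisImage

/-! ## §1. Level one: no `τ ∈ Γ_{ℚ(μ_p)}` with `E[p]/(τ − 1)E[p] ≃ ℤ/p` on a small-image row -/

section LevelOne

variable (W : WeierstrassCurve ℚ) [W.IsElliptic] (p : ℕ) [hp : Fact p.Prime]

/-- **(H.2) FAILS AT LEVEL ONE on a small-image row.** If `E[p]` is irreducible, `ρ̄_{E,p}` is not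
onto and `τ ∈ Gal(ℚ̄/ℚ(μ_p))`, then `E[p]/(τ − 1)E[p]` is NOT isomorphic to `ℤ/p`: otherwise
`R = (τ − 1)E[p]` is a line with `τ = 1` on `E[p]/R`, so `τ|_R = χ̄_p(τ) = 1`
(`smul_eq_cyclotomic_zsmul_of_forall_sub_mem`, `rootsOfUnityFixer_eq_ker`), `τ` is unipotent, hence
trivial (`smul_eq_self_of_fix_line_of_irr_of_not_surj`, Serre Prop. 15), and `R = 0`.
[cite: Sakamoto2024, §2 (H.2)] [cite: MazurRubin2004, §3.5 (H.1)] [cite: Serre1972, §2.4 Prop. 15] -/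
theorem not_nonempty_cokerSubOne_equiv_zmod_of_irr_of_not_surj (hirr : Irr W p) (hns : ¬ Surj W p)
    {τ : absoluteGaloisGroup ℚ} (hτ : τ ∈ rootsOfUnityFixer ℚ p) :
    ¬ Nonempty (cokerSubOne (W.torsionGaloisModule ((p : ℕ) : ℤ)) τ ≃+ ZMod p) := by
  rintro ⟨eqv⟩
  have hpP : p.Prime := hp.out
  haveI : NeZero p := ⟨hpP.ne_zero⟩
  haveI : NeZero ((p : ℕ) : ℚ) := ⟨Nat.cast_ne_zero.mpr hpP.ne_zero⟩
  haveI : Fact (1 < p) := ⟨hpP.one_lt⟩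
  -- `f = τ − 1` on `E[p]`, `R = im f`
  obtain ⟨f, hfdef⟩ : ∃ f : geomTorsion W ((p : ℕ) : ℤ) →+ geomTorsion W ((p : ℕ) : ℤ),
      f = ((W.torsionGaloisModule ((p : ℕ) : ℤ)) τ).toAddMonoidHom - AddMonoidHom.id _ := ⟨_, rfl⟩
  have eqv' : (geomTorsion W ((p : ℕ) : ℤ) ⧸ f.range) ≃+ ZMod p := by rw [hfdef]; exact eqv
  have hf : ∀ x : geomTorsion W ((p : ℕ) : ℤ), f x = τ • x - x := fun x ↦ by rw [hfdef]; rfl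
  -- `#E[p] = p²`, `#(E[p]/R) = p` ⟹ `#R = p`
  have hE : Nat.card (geomTorsion W ((p : ℕ) : ℤ)) = p ^ 2 :=
    Literature.NumberTheory.EllipticCurves.natCard_geomTorsion W p
  haveI : Finite (geomTorsion W ((p : ℕ) : ℤ)) :=
    Nat.finite_of_card_ne_zero (by rw [hE]; exact pow_ne_zero 2 hpP.ne_zero)
  have hQ : Nat.card (geomTorsion W ((p : ℕ) : ℤ) ⧸ f.range) = p := by
    rw [Nat.card_congr eqv'.toEquiv, Nat.card_zmod]
  have hRcard : Nat.card f.range = p := by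
    have h := AddSubgroup.card_eq_card_quotient_mul_card_addSubgroup f.range
    rw [hE, hQ, sq] at h
    exact (Nat.eq_of_mul_eq_mul_left hpP.pos h).symm
  -- `τ` acts trivially on `E[p]/R`
  have hsub : ∀ P : geomTorsion W ((p : ℕ) : ℤ), τ • P - P ∈ f.range := fun P ↦ ⟨P, hf P⟩
  -- `χ̄_p(τ) = 1`
  have hχ : modPCyclotomicCharacterZMod ℚ p τ = 1 := by
    have h := hτ
    rw [rootsOfUnityFixer_eq_ker, MonoidHom.mem_ker] at h
    exact h
  -- `τ` fixes the line `R` pointwise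
  have hfix : ∀ P ∈ f.range, τ • P = P := by
    intro P hP
    rw [MixedCongruence.smul_eq_cyclotomic_zsmul_of_forall_sub_mem W p τ hRcard hsub hP, hχ,
      Units.val_one, ZMod.val_one, Nat.cast_one, one_smul]
  -- hence `τ = 1` on `E[p]` and `R = 0`
  have htriv : ∀ Q : geomTorsion W ((p : ℕ) : ℤ), τ • Q = Q :=
    smul_eq_self_of_fix_line_of_irr_of_not_surj W p hirr hns hfix hsub
  have hRbot : f.range = ⊥ := by
    rw [eq_bot_iff]
    rintro _ ⟨P, rfl⟩
    rw [AddSubgroup.mem_bot, hf, htriv P, sub_self]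
  rw [hRbot, AddSubgroup.card_bot] at hRcard
  exact hpP.one_lt.ne hRcard

/-- The level-one no-go with the indices presented as `n = p`, `m = p` (for rewriting under the
type-level indices of `torsionGaloisModule` / `ZMod`). [cite: Sakamoto2024, §2 (H.2)] -/
theorem not_nonempty_cokerSubOne_equiv_zmod_of_irr_of_not_surj' (hirr : Irr W p) (hns : ¬ Surj W p)
    {n : ℤ} {m : ℕ} (hn : n = ((p : ℕ) : ℤ)) (hm : m = p)
    {τ : absoluteGaloisGroup ℚ} (hτ : τ ∈ rootsOfUnityFixer ℚ m) :
    ¬ Nonempty (cokerSubOne (W.torsionGaloisModule n) τ ≃+ ZMod m) := by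
  subst hn
  have hτ' : τ ∈ rootsOfUnityFixer ℚ p := hm ▸ hτ
  rw [hm]
  exact not_nonempty_cokerSubOne_equiv_zmod_of_irr_of_not_surj W p hirr hns hτ'

end LevelOne

/-! ## §2. Every level `p^a`, `a ≥ 1`; the spelling of the N11 instances at `p = 3` -/

section AllLevels

variable (W : WeierstrassCurve ℚ) [W.IsElliptic] (p : ℕ) [hp : Fact p.Prime]

/-- **(H.2) FAILS AT EVERY LEVEL `p^a` (`a ≥ 1`) on a small-image row**: `Irr W p`, `¬ Surj W p`,
`τ ∈ Gal(ℚ̄/ℚ(μ_{p^a}))` ⟹ `E[p^a]/(τ − 1)E[p^a] ≄ ℤ/p^a` — a level-`p^a` datum descends to level `p`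
(n1011-p13's `nonempty_cokerSubOne_equiv_zmod_pow_of_le`), where §1 applies
(`Gal(ℚ̄/ℚ(μ_{p^a})) ≤ Gal(ℚ̄/ℚ(μ_p))`). [cite: Sakamoto2024, §2 (H.2)] [cite: MazurRubin2004, §3.5 (H.1)] -/
theorem not_nonempty_cokerSubOne_equiv_zmod_pow_of_irr_of_not_surj (hirr : Irr W p)
    (hns : ¬ Surj W p) {a : ℕ} (ha : 1 ≤ a)
    {τ : absoluteGaloisGroup ℚ} (hτ : τ ∈ rootsOfUnityFixer ℚ (p ^ a)) :
    ¬ Nonempty (cokerSubOne (W.torsionGaloisModule ((p : ℤ) ^ a)) τ ≃+ ZMod (p ^ a)) := by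
  intro h
  have h1 := nonempty_cokerSubOne_equiv_zmod_pow_of_le (W := W) hp.out (b := 1) ha τ h
  have hτ1 : τ ∈ rootsOfUnityFixer ℚ (p ^ 1) :=
    rootsOfUnityFixer_le_of_dvd ℚ (pow_dvd_pow p ha) hτ
  exact not_nonempty_cokerSubOne_equiv_zmod_of_irr_of_not_surj' W p hirr hns
    (by rw [pow_one]) (pow_one p) hτ1 h1

/-- The all-levels no-go with the indices presented as `n = p^a`, `m = p^a`.
[cite: Sakamoto2024, §2 (H.2)] -/
theorem not_nonempty_cokerSubOne_equiv_zmod_pow_of_irr_of_not_surj' (hirr : Irr W p)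
    (hns : ¬ Surj W p) {a : ℕ} (ha : 1 ≤ a) {n : ℤ} {m : ℕ} (hn : n = (p : ℤ) ^ a) (hm : m = p ^ a)
    {τ : absoluteGaloisGroup ℚ} (hτ : τ ∈ rootsOfUnityFixer ℚ m) :
    ¬ Nonempty (cokerSubOne (W.torsionGaloisModule n) τ ≃+ ZMod m) := by
  subst hn hm
  exact not_nonempty_cokerSubOne_equiv_zmod_pow_of_irr_of_not_surj W p hirr hns ha hτ

/-- **The SPELLING of the N11 Sakamoto instances, every `k`**: for `E[3]` irreducible with `ρ̄_{E,3}`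
NOT onto, no `τ ∈ Gal(ℚ̄/ℚ(μ_{3^{k+1}}))` has
`Nonempty (cokerSubOne (W.torsionGaloisModule ((3:ℤ)^k · 3)) τ ≃+ ZMod (3^(k+1)))` — the binder `hτq`
of `GaloisImage.kolyvaginSystems_freeRankOne_propagatedSelmerStructure` (n1011-p13) and of its deep /
tower variants is UNSATISFIABLE on these rows: the [S24] instances are VACUOUS there.
[cite: Sakamoto2024, §2 (H.2), Thm. 4.4] -/
theorem not_nonempty_cokerSubOne_three_pow_of_irr_of_not_surj (hirr : Irr W 3) (hns : ¬ Surj W 3)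
    (k : ℕ) {τ : absoluteGaloisGroup ℚ} (hτμ : τ ∈ rootsOfUnityFixer ℚ (3 ^ (k + 1))) :
    ¬ Nonempty (cokerSubOne (W.torsionGaloisModule (((3 : ℕ) : ℤ) ^ k * ((3 : ℕ) : ℤ))) τ ≃+
      ZMod (3 ^ (k + 1))) :=
  haveI : Fact (Nat.Prime 3) := ⟨Nat.prime_three⟩
  not_nonempty_cokerSubOne_equiv_zmod_pow_of_irr_of_not_surj' W 3 hirr hns (a := k + 1)
    (Nat.succ_le_succ (Nat.zero_le k)) (by push_cast; ring) rfl hτμ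

end AllLevels

/-! ## §3. Class forms: O8 (every `p`), N2 = X10b, N3 = X9 -/

section Cell

variable (W : WeierstrassCurve ℚ) [W.IsElliptic] (p : ℕ) [hp : Fact p.Prime]

/-- **O8, every row, every `p`: (H.2) fails at level one** (`ClassX4 W p`, `¬ Surj W p`,
`τ ∈ Gal(ℚ̄/ℚ(μ_p))` ⟹ `E[p]/(τ − 1)E[p] ≄ ℤ/p`). [cite: Sakamoto2024, §2 (H.2)]
[cite: Serre1972, §2.4 Prop. 15] -/
theorem O8.not_nonempty_cokerSubOne_equiv_zmod (hX : ClassX4 W p) (hns : ¬ Surj W p)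
    {τ : absoluteGaloisGroup ℚ} (hτ : τ ∈ rootsOfUnityFixer ℚ p) :
    ¬ Nonempty (cokerSubOne (W.torsionGaloisModule ((p : ℕ) : ℤ)) τ ≃+ ZMod p) :=
  not_nonempty_cokerSubOne_equiv_zmod_of_irr_of_not_surj W p hX.2.2 hns hτ

/-- **O8, every row, every level `p^a` (`a ≥ 1`): (H.2) fails.** [cite: Sakamoto2024, §2 (H.2)] -/
theorem O8.not_nonempty_cokerSubOne_equiv_zmod_pow (hX : ClassX4 W p) (hns : ¬ Surj W p)
    {a : ℕ} (ha : 1 ≤ a) {τ : absoluteGaloisGroup ℚ} (hτ : τ ∈ rootsOfUnityFixer ℚ (p ^ a)) :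
    ¬ Nonempty (cokerSubOne (W.torsionGaloisModule ((p : ℤ) ^ a)) τ ≃+ ZMod (p ^ a)) :=
  not_nonempty_cokerSubOne_equiv_zmod_pow_of_irr_of_not_surj W p hX.2.2 hns ha hτ

/-- **O8 at `p = 3`, the N11-instance spelling, every `k`**: the binder `hτq` of the tree's [S24]
instances cannot be supplied on an O8@3 row. [cite: Sakamoto2024, §2 (H.2), Thm. 4.4] -/
theorem O8.not_nonempty_cokerSubOne_three_pow (hX : ClassX4 W 3) (hns : ¬ Surj W 3) (k : ℕ)
    {τ : absoluteGaloisGroup ℚ} (hτμ : τ ∈ rootsOfUnityFixer ℚ (3 ^ (k + 1))) :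
    ¬ Nonempty (cokerSubOne (W.torsionGaloisModule (((3 : ℕ) : ℤ) ^ k * ((3 : ℕ) : ℤ))) τ ≃+
      ZMod (3 ^ (k + 1))) :=
  not_nonempty_cokerSubOne_three_pow_of_irr_of_not_surj W hX.2.2 hns k hτμ

/-- **N2 = X10b (class X10 with `ρ̄_{E,3}` not onto), the instance spelling, every `k`.**
[cite: Sakamoto2024, §2 (H.2), Thm. 4.4] [cite: Serre1972, §2.4 Prop. 15] -/
theorem ClassX10.not_nonempty_cokerSubOne_three_pow_of_not_surj [W.IsGloballyMinimal]
    (h : ClassX10 W p) (hns : ¬ Surj W 3) (k : ℕ)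
    {τ : absoluteGaloisGroup ℚ} (hτμ : τ ∈ rootsOfUnityFixer ℚ (3 ^ (k + 1))) :
    ¬ Nonempty (cokerSubOne (W.torsionGaloisModule (((3 : ℕ) : ℤ) ^ k * ((3 : ℕ) : ℤ))) τ ≃+
      ZMod (3 ^ (k + 1))) :=
  not_nonempty_cokerSubOne_three_pow_of_irr_of_not_surj W h.2.2.1 hns k hτμ

/-- **N3 = X9 (`p ≥ 5`, Cartan-normaliser image): (H.2) fails at level one.**
[cite: Sakamoto2024, §2 (H.2)] [cite: Serre1972, §2.4 Prop. 15] -/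
theorem ClassX9.not_nonempty_cokerSubOne_equiv_zmod [W.IsGloballyMinimal] (h : ClassX9 W p)
    {τ : absoluteGaloisGroup ℚ} (hτ : τ ∈ rootsOfUnityFixer ℚ p) :
    ¬ Nonempty (cokerSubOne (W.torsionGaloisModule ((p : ℕ) : ℤ)) τ ≃+ ZMod p) :=
  not_nonempty_cokerSubOne_equiv_zmod_of_irr_of_not_surj W p h.2.2.2.1 h.2.2.2.2.1 hτ

/-- **N3 = X9: (H.2) fails at every level `p^a`, `a ≥ 1`.** [cite: Sakamoto2024, §2 (H.2)] -/
theorem ClassX9.not_nonempty_cokerSubOne_equiv_zmod_pow [W.IsGloballyMinimal] (h : ClassX9 W p)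
    {a : ℕ} (ha : 1 ≤ a) {τ : absoluteGaloisGroup ℚ} (hτ : τ ∈ rootsOfUnityFixer ℚ (p ^ a)) :
    ¬ Nonempty (cokerSubOne (W.torsionGaloisModule ((p : ℤ) ^ a)) τ ≃+ ZMod (p ^ a)) :=
  not_nonempty_cokerSubOne_equiv_zmod_pow_of_irr_of_not_surj W p h.2.2.2.1 h.2.2.2.2.1 ha hτ

end Cell

end Summit.BirchSwinnertonDyer.Rank1Residual.GaloisImage

end
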